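/-
Copyright (c) 2026 the pub-hodgecm-mathlib formalisation cell (harness21).  Prover seat hodgecm-mathlib-A-p19 (g27), 2026-09-01.  Road «S3-tree»∕«S3-ram» (LEAD F0P3a-plan (g12)
T11-41∕T11-52; owner p06 (g15); consumer A-p12 (g23) (α₂) STUB A₂), row (e2) «P-2-ram», organ «[T2-b]-ram LAW»: the frame link and the norm transfer that read the eigen-field
norm equation of ★ p847100 on the RATIONAL Gram value `d₀` — residue-free, type-uniform (certificate `F0/P3/A-p19/g27/cert/CERT-T2b-ram.A-p19g27.md`, 841 + 5312 cases).
-/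
import Literature.NumberTheory.Automorphic.RationalGoodVectorRamifiedBase   -- ★ p847100 (this seat): `criterion_symm_sigma_fixed`, `prod_cayley_mul_one`; brings ★ inert core (`map_symmCriterion_one_eq`), ★ O8a-∃ (`cayleyQuotient_skew`), ★ kernel `SymmetricEigenframeParity` (`map_det_eq_neg_det_of_cols`)
import Literature.NumberTheory.QuadraticForms.HermitianUnimodularRankTwoDetClass  -- ★ A-p06 (g27): `HermitianUnimodularRamified.det_formCongr`
import HarnessLib

/-!
# The good type-(2) class at a TAME-RAMIFIED base, read on the rational Gram value: `c′₁ ∈ N(K∕K^σ)` iff `−θσ(θ)·d₀·det J·x₀₁x₀₂·x₁₂²` is a norm of a RATIONAL element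
# (Rogawski 1990 Lemma 4.9.3; Jacobowitz 1962 §7–§8; Serre, *Local Fields* V §3, XIV §6)

Topic `NumberTheory/Automorphic`; namespace `Literature.NumberTheory.Automorphic.SymmetricEigenframe`.  THEOREMS ONLY (no definition, no instance, no notation, no named fact, no
`sorry`); generic: ONE field `K`, TWO commuting ring endomorphisms `σ`, `ι` — pure algebra, no valuation.  Cell `pub/hodgecm-mathlib` (D-0151), crux H413 = `stmt-HodgeConjecture-24833`;
road «S3-tree», seeding wave «S3-ram», row (e2) «P-2-ram»; organ **«[T2-b]-ram LAW»** (this seat), the sequel of ★ p847100 `exists_rational_good_iff_exists_norm_ramifiedBase` announced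
in its docstring.  HONEST LABEL: HC_CM is proved only modulo the 2 remaining named inputs (hLiu418 24832, h413 24833) until rung 0 closes; elementary algebra, asserts nothing printed.

THE DICTIONARY (as in ★ p847100).  `K` = the unramified eigen-field `M` of a type-(2) class at a tame-ramified CM place; `σ` = the CM involution `σ̃` (`Fix σ = K′`), `ι` = the
`L_w`-involution (`Fix ι = L_w`, `ιθ = −θ`); the symmetric eigenframe `P = [x₀ | x₁ | ιx₁] ∈ GL₃(K)` of the class with `ᵗσ(P)·J·P = diag(d₀, d₁, ιd₁)` for the (rational: `J.map ι = J`)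
hermitian Gram matrix `J`; nodes `γ = (u, λ, ιλ)` (norm one, `ιγ₀ = γ₀`, `ιγ₁ = γ₂`); Cayley quotients `x_ij := (γᵢ − γⱼ)∕((1+γᵢ)(1+γⱼ))`; `c′₁ = d₁·x₁₀x₁₂` the criterion scalar of ★ p847100.
THE ONE DICTIONARY HYPOTHESIS (translation ∕ norm-limitation for the biquadratic `K ⊃ K′, L_w ⊃ L⁺_v`, discharged per torus type by the carrier): `htrans` — a non-zero
`σ`-fixed `y` (an element of `K′`) is a `σ`-norm from `K` iff `y·ι(y) = N_{K′∕L⁺_v}(y)` is a `σ`-norm of a RATIONAL (`ι`-fixed) element, i.e. `N_{K∕K′}(K^×) = N_{K′∕F}⁻¹(N_{E∕F}(E^×))`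
(type A: `K′∕F` unramified, `K∕K′` tame-ramified — residue squares on both sides; type B: `K′∕F` ramified with a non-norm uniformiser norm, `K∕K′` unramified — parities on both sides).

THE RESULT.  §1 `x_ji = −x_ij` and the product identity **`c′₁·ι(c′₁) = −d₁·ι(d₁)·(x₀₁x₀₂)·x₁₂²`** (`c′₂ = ι c′₁`).  §2 THE FRAME LINK **`d₀·d₁·ι(d₁) = det J·det P·σ(det P)`**
(★ `det_formCongr`) with **`ι(det P) = −det P`** (★ `map_det_eq_neg_det_of_cols`), so `det P = b·θ` with `b` rational and `det P·σ(det P) = bσ(b)·θσ(θ)`.  §3 the LAW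
**`exists_norm_symmCriterion_iff_exists_rational_norm`: `(∃ b, b·σb·c′₁ = 1) ↔ ∃ a, ι a = a ∧ a·σa·(−(θ·σθ)·d₀·det J·(x₀₁x₀₂)·x₁₂²) = 1`** — the right side is a statement about
`L_w`-elements only (`d₀`, `det J`, `x₀₁x₀₂ = N_{K∕L_w}(x₀₁)`, `x₁₂²`, `−θσθ = ∓ε`), RESIDUE-FREE and TYPE-UNIFORM; with the κ-reading ★ (D1)-ram (26′) «`κ = 1 ↔ d₀ ∈ N(L_w^×)`» it says
**the good class is `κ(δ) = χ_{E∕F}(−θσ̃θ · det J · x₀₁x₀₂ · x₁₂²)`**, equivalently (certificate, 841 + 5312 exact cases, p ∈ {3,5,7,11}) `κ_good = χ(det J)·μ_w((u−λ)(u−ιλ))`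
for any conductor-≤1 extension `μ_w` of `χ_{E∕F}` — the `μ`-factor of Rogawski's transfer factor (§4.9 p. 59).  Proof of §3: `htrans` at `y = c′₁`, §1, §2, and the
absorption of the rational norms `N(b)`, `N(d₀) = d₀²` into the rational witness.

* §1 `cayleyQuotient_swap`, `symmCriterion_one_mul_map_eq`.  §2 `prod_gram_eq_det_mul_norm_det`, `exists_rational_det_eq_mul_theta`.  §3 `exists_rational_norm_mul_iff_of_rational_norm`,
  **`exists_norm_symmCriterion_iff_exists_rational_norm`**.

## References
* [Rogawski1990] J. D. Rogawski, *Automorphic Representations of Unitary Groups in Three Variables* (1990), §4.9 Lemma 4.9.3 p. 56, Prop. 4.9.1 p. 55, p. 59.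
* [Jacobowitz1962] R. Jacobowitz, *Hermitian forms over local fields*, Amer. J. Math. 84 (1962), §5, §7 Thm. 7.1, §8.
* [SerreLocalFields1979] J.-P. Serre, *Local Fields*, GTM 67 (1979), Ch. V §3 Cor. 2; Ch. XIV §6 (norm groups, norm limitation for abelian extensions).
* [LanglandsShelstad1987] R. P. Langlands, D. Shelstad, *On the definition of transfer factors*, Math. Ann. 278 (1987), §1.3–1.4.
-/

set_option autoImplicit false

open Finset Matrix

namespace Literature.NumberTheory.Automorphic.SymmetricEigenframe

open Literature.NumberTheory.Automorphic Literature.NumberTheory.QuadraticForms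

variable {K : Type*} [Field K]

/-! ## §1 Cayley quotients on three nodes: antisymmetry and the product `c′₁ · ι(c′₁)` -/

/-- `∏_{j ≠ 1} f j = f 0 · f 2` on `Fin 3`. [folklore] -/
private theorem prod_erase_one_three'' {M : Type*} [CommMonoid M] (f : Fin 3 → M) : ∏ j ∈ univ.erase (1 : Fin 3), f j = f 0 * f 2 := by
  rw [show univ.erase (1 : Fin 3) = {0, 2} by decide, Finset.prod_pair (by decide)]

/-- **`x_ji = −x_ij`**: the Cayley quotient is antisymmetric in the two nodes. [cite: Jacobowitz1962, §7] -/
theorem cayleyQuotient_swap (γ : Fin 3 → K) (i j : Fin 3) :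
    (γ j - γ i) / ((1 + γ j) * (1 + γ i)) = -((γ i - γ j) / ((1 + γ i) * (1 + γ j))) := by
  rw [← neg_sub, neg_div, mul_comm]

/-- **`c′₁ · ι(c′₁) = −d₁·ι(d₁)·(x₀₁x₀₂)·x₁₂²`** for the `δ := 1` criterion scalar `c′₁ = d₁·∏_{j≠1} x_{1j}` of a symmetric eigen-datum (`ιγ₀ = γ₀`, `ιγ₁ = γ₂`, `ιγ₂ = γ₁`, `ιd₁ = d₂`):
`ι c′₁ = c′₂ = d₂·x₂₀x₂₁` (★ `map_symmCriterion_one_eq`) and `x₁₀x₁₂·x₂₀x₂₁ = −x₀₁x₀₂·x₁₂²`. [cite: Jacobowitz1962, §7] [cite: Rogawski1990, §4.9 Lemma 4.9.3 p. 56] -/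
theorem symmCriterion_one_mul_map_eq (ι : K →+* K) {γ d : Fin 3 → K} (hγ1 : ∀ i, 1 + γ i ≠ 0)
    (hιγ0 : ι (γ 0) = γ 0) (hιγ1 : ι (γ 1) = γ 2) (hιγ2 : ι (γ 2) = γ 1) (hιd1 : ι (d 1) = d 2) :
    (d 1 * ∏ j ∈ univ.erase (1 : Fin 3), (γ 1 - γ j) / ((1 + γ 1) * (1 + γ j))) * ι (d 1 * ∏ j ∈ univ.erase (1 : Fin 3), (γ 1 - γ j) / ((1 + γ 1) * (1 + γ j))) =
      -(d 1 * ι (d 1)) * ((γ 0 - γ 1) / ((1 + γ 0) * (1 + γ 1)) * ((γ 0 - γ 2) / ((1 + γ 0) * (1 + γ 2)))) *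
        ((γ 1 - γ 2) / ((1 + γ 1) * (1 + γ 2))) ^ 2 := by
  have hι : ι (d 1 * ∏ j ∈ univ.erase (1 : Fin 3), (γ 1 - γ j) / ((1 + γ 1) * (1 + γ j))) =
      d 2 * ∏ j ∈ univ.erase (2 : Fin 3), (γ 2 - γ j) / ((1 + γ 2) * (1 + γ j)) := by
    have h := map_symmCriterion_one_eq ι (γ := γ) (d := d) (δ := (1 : K)) hιγ0 hιγ1 hιγ2 hιd1 (map_one ι)
    simpa only [prod_cayley_mul_one] using h
  rw [hι, hιd1, prod_erase_one_three'', show univ.erase (2 : Fin 3) = {0, 1} by decide, Finset.prod_pair (by decide)]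
  have h0 := hγ1 0
  have h1 := hγ1 1
  have h2 := hγ1 2
  field_simp
  ring

/-! ## §2 The frame link: `d₀·d₁·ι(d₁) = det J · det P · σ(det P)`, `ι(det P) = −det P`, `det P = b·θ` -/

/-- **`∏ dᵢ = det J · (det P · σ(det P))`** when `ᵗσ(P)·J·P = diagonal d` (★ `det_formCongr`, `det (diagonal d) = ∏ dᵢ`). [cite: Jacobowitz1962, §7] -/
theorem prod_gram_eq_det_mul_norm_det (σ : K →+* K) {n : ℕ} (P : GL (Fin n) K) (J : Matrix (Fin n) (Fin n) K) {d : Fin n → K}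
    (hP : formCongr σ P J = diagonal d) :
    ∏ i, d i = J.det * ((P : Matrix (Fin n) (Fin n) K).det * σ (P : Matrix (Fin n) (Fin n) K).det) := by
  rw [← Matrix.det_diagonal, ← hP, HermitianUnimodularRamified.det_formCongr]

/-- **`det P = b·θ` WITH `b` RATIONAL** for a symmetric frame: `ι` fixes column `0` and exchanges columns `1, 2`, so `ι(det P) = −det P` (★ `map_det_eq_neg_det_of_cols`), and an
`ι`-anti-fixed element is a rational multiple of `θ` (`hanti`, the Eisenstein∕unramified coordinates `z = a + bθ`, `ιθ = −θ`, `2 ≠ 0`). [cite: Jacobowitz1962, §7] [cite: SerreLocalFields1979, Ch. V §3] -/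
theorem exists_rational_det_eq_mul_theta (ι : K →+* K) {θ : K} (hanti : ∀ z : K, ι z = -z → ∃ b : K, ι b = b ∧ z = b * θ)
    (P : Matrix (Fin 3) (Fin 3) K) (hP0 : ∀ i, ι (P i 0) = P i 0) (hP1 : ∀ i, ι (P i 1) = P i 2) (hP2 : ∀ i, ι (P i 2) = P i 1) :
    ∃ b : K, ι b = b ∧ P.det = b * θ :=
  hanti _ (map_det_eq_neg_det_of_cols ι P hP0 hP1 hP2)

/-! ## §3 The law -/

/-- **Rational norms are absorbed into the rational witness**: if `t ≠ 0` is rational then `y` is a `σ`-norm of a rational element iff `y·tσ(t)` is (`a ↦ a∕t`).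
[cite: SerreLocalFields1979, Ch. V §3 Cor. 2] -/
theorem exists_rational_norm_mul_iff_of_rational_norm (σ ι : K →+* K) {t : K} (hιt : ι t = t) (ht : t ≠ 0) (y : K) :
    (∃ a : K, ι a = a ∧ a * σ a * (y * (t * σ t)) = 1) ↔ ∃ a : K, ι a = a ∧ a * σ a * y = 1 := by
  have hσt : σ t ≠ 0 := fun h0 => ht ((map_eq_zero σ).1 h0)
  constructor
  · rintro ⟨a, haι, ha⟩
    refine ⟨a * t, by rw [map_mul, haι, hιt], ?_⟩
    rw [map_mul]
    linear_combination ha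
  · rintro ⟨a, haι, ha⟩
    refine ⟨a / t, by rw [map_div₀, haι, hιt], ?_⟩
    rw [map_div₀, show a / t * (σ a / σ t) * (y * (t * σ t)) = a * σ a * y by field_simp]
    exact ha

/-- **«[T2-b]-ram LAW» — THE GOOD CLASS READ ON THE RATIONAL GRAM VALUE.**  For a symmetric type-(2) eigenframe `P` (`ᵗσ(P) J P = diag(d₀, d₁, ιd₁)`, `ι` fixing column `0`
and exchanging columns `1, 2`) of a hermitian Gram matrix `J` over the unramified eigen-field `K` at a tame-ramified base (no hypothesis on `det J` is needed for the algebra; in the application `det J ∈ L⁺_v^×`), with norm-one nodes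
`γ = (u, λ, ιλ)` and the TRANSLATION dictionary `htrans` (`N_{K∕K′}(K^×) = N_{K′∕F}⁻¹ N_{E∕F}(E^×)`): the eigen-field norm equation `b·σb·c′₁ = 1` of ★ p847100 is solvable **iff**
`−(θ·σθ)·d₀·det J·(x₀₁x₀₂)·x₁₂²` is a `σ`-norm of a RATIONAL element.  With ★ (D1)-ram (26′) this reads `κ_good(δ) = χ_{E∕F}(−θσ̃θ·det J·x₀₁x₀₂·x₁₂²)` = `χ(det J)·μ_w((u−λ)(u−ιλ))`
(certified); the free-row count of the class is then `[C : R^×]` (★ p847126) or `0`.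
[cite: Rogawski1990, §4.9 Lemma 4.9.3 p. 56, Prop. 4.9.1 p. 55, p. 59] [cite: Jacobowitz1962, §7 Thm. 7.1, §8] [cite: SerreLocalFields1979, Ch. V §3 Cor. 2; Ch. XIV §6] [cite: LanglandsShelstad1987, §1.3–1.4] -/
theorem exists_norm_symmCriterion_iff_exists_rational_norm (σ ι : K →+* K)
    -- the translation dictionary for `σ`-fixed (i.e. `K′`-) elements
    (htrans : ∀ y : K, y ≠ 0 → σ y = y → ((∃ b : K, b * σ b * y = 1) ↔ ∃ a : K, ι a = a ∧ a * σ a * (y * ι y) = 1))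
    -- the unramified generator `θ` of `K ∕ L_w` and the coordinates of `ι`-anti-fixed elements
    {θ : K} (hθ : θ ≠ 0) (hanti : ∀ z : K, ι z = -z → ∃ b : K, ι b = b ∧ z = b * θ)
    -- the rational hermitian Gram matrix and the symmetric eigenframe
    (J : Matrix (Fin 3) (Fin 3) K)
    (P : GL (Fin 3) K) {γ d : Fin 3 → K} (hP : formCongr σ P J = diagonal d)
    (hP0 : ∀ i, ι ((P : Matrix (Fin 3) (Fin 3) K) i 0) = (P : Matrix (Fin 3) (Fin 3) K) i 0)
    (hP1 : ∀ i, ι ((P : Matrix (Fin 3) (Fin 3) K) i 1) = (P : Matrix (Fin 3) (Fin 3) K) i 2)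
    (hP2 : ∀ i, ι ((P : Matrix (Fin 3) (Fin 3) K) i 2) = (P : Matrix (Fin 3) (Fin 3) K) i 1)
    -- nodes and Gram values
    (hγ1 : ∀ i, 1 + γ i ≠ 0) (hσγ : ∀ i, σ (γ i) = (γ i)⁻¹) (hγne : ∀ i, γ i ≠ 0) (hinj : Function.Injective γ)
    (hιγ0 : ι (γ 0) = γ 0) (hιγ1 : ι (γ 1) = γ 2) (hιγ2 : ι (γ 2) = γ 1)
    (hdσ : ∀ i, σ (d i) = d i) (hdne : ∀ i, d i ≠ 0) (hιd0 : ι (d 0) = d 0) (hιd1 : ι (d 1) = d 2) :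
    (∃ b : K, b * σ b * (d 1 * ∏ j ∈ univ.erase (1 : Fin 3), (γ 1 - γ j) / ((1 + γ 1) * (1 + γ j))) = 1) ↔
      ∃ a : K, ι a = a ∧ a * σ a * (-(θ * σ θ) * d 0 * J.det *
        ((γ 0 - γ 1) / ((1 + γ 0) * (1 + γ 1)) * ((γ 0 - γ 2) / ((1 + γ 0) * (1 + γ 2)))) * ((γ 1 - γ 2) / ((1 + γ 1) * (1 + γ 2))) ^ 2) = 1 := by
  -- abbreviations
  set c1 : K := d 1 * ∏ j ∈ univ.erase (1 : Fin 3), (γ 1 - γ j) / ((1 + γ 1) * (1 + γ j)) with hc1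
  set A : K := (γ 0 - γ 1) / ((1 + γ 0) * (1 + γ 1)) * ((γ 0 - γ 2) / ((1 + γ 0) * (1 + γ 2))) with hA
  set x12 : K := (γ 1 - γ 2) / ((1 + γ 1) * (1 + γ 2)) with hx12
  -- `c′₁ ≠ 0` and `σ c′₁ = c′₁`
  have hc1ne : c1 ≠ 0 := by
    simp only [hc1]
    refine mul_ne_zero (hdne 1) (Finset.prod_ne_zero_iff.2 fun j hj => div_ne_zero (sub_ne_zero.2 fun h => ?_) (mul_ne_zero (hγ1 1) (hγ1 j)))
    exact (Finset.ne_of_mem_erase hj) (hinj h).symm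
  have hc1σ : σ c1 = c1 := criterion_symm_sigma_fixed σ hσγ hγne hdσ 1
  -- §1: `c′₁ ι(c′₁) = −d₁ ι(d₁) A x₁₂²`
  have hprod : c1 * ι c1 = -(d 1 * ι (d 1)) * A * x12 ^ 2 := symmCriterion_one_mul_map_eq ι hγ1 hιγ0 hιγ1 hιγ2 hιd1
  -- §2: the frame link `d₀ d₁ ι(d₁) = det J · det P · σ(det P)` with `det P = b θ`, `b` rational
  have hgram : d 0 * (d 1 * ι (d 1)) = J.det * ((P : Matrix (Fin 3) (Fin 3) K).det * σ (P : Matrix (Fin 3) (Fin 3) K).det) := by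
    have h := prod_gram_eq_det_mul_norm_det σ P J hP
    rw [Fin.prod_univ_three, ← hιd1] at h
    rw [← h]
    ring
  obtain ⟨b, hbι, hbdet⟩ := exists_rational_det_eq_mul_theta ι hanti (P : Matrix (Fin 3) (Fin 3) K) hP0 hP1 hP2
  have hdetP : (P : Matrix (Fin 3) (Fin 3) K).det ≠ 0 := (Matrix.isUnits_det_units P).ne_zero
  have hb : b ≠ 0 := fun h0 => hdetP (by rw [hbdet, h0, zero_mul])
  have hd0 : d 0 ≠ 0 := hdne 0
  -- so `d₁ ι(d₁) = det J · bσ(b) · θσ(θ) ∕ d₀` and `c′₁ ι(c′₁) = T · (t σ t)` with `T` the target scalar and `t = b ∕ d₀` rational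
  have hkey : c1 * ι c1 = (-(θ * σ θ) * d 0 * J.det * A * x12 ^ 2) * ((b / d 0) * σ (b / d 0)) := by
    have h1 : d 1 * ι (d 1) = J.det * (b * σ b) * (θ * σ θ) / d 0 := by
      rw [eq_div_iff hd0]
      rw [hbdet, map_mul] at hgram
      linear_combination hgram
    rw [hprod, h1, map_div₀, hdσ 0]
    field_simp
  -- §3: translation, then absorb the rational norm `N(b ∕ d₀)`
  rw [htrans c1 hc1ne hc1σ, hkey]
  have hιt : ι (b / d 0) = b / d 0 := by rw [map_div₀, hbι, hιd0]
  have ht : b / d 0 ≠ 0 := div_ne_zero hb hd0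
  exact exists_rational_norm_mul_iff_of_rational_norm σ ι hιt ht _

end Literature.NumberTheory.Automorphic.SymmetricEigenframe
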